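import Literature.Computability.Complexity.ApproximationProofs
import Literature.Computability.Complexity.GabberGalilKit

/-!
# Bounded-occurrence gap-E3SAT is NP-hard, from the tree's PCP machine
(stub `stub_gapE3SATB` of line `prg-image-exact-threshold-lift`)

Crux `Summit.PneNP.PneNP.Theses.PhaseTwins.PseudorandomTwinsAbove` (item stmt-PneNP-2721), step S2a.

For every `NP` language `L` there are `g ∈ FP`, a gap `γ > 0` and an occurrence bound `B` such that `g`
maps EVERY string `y` to the code of an E3-CNF in which every variable occurs in at most `B` clauses,
satisfiable if `y ∈ L` and of value `≤ 1 - γ` if `y ∉ L` (`stub_gapE3SATB`).  The map is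
`g := GapPV.ggMachine.g ∘ r` with `r` the Cook–Levin reduction to `kSAT 3`
(`isNPComplete_kSAT_three_holds`) and `GapPV.ggMachine` the tree's gap machine of Dinur's proof of the
PCP theorem on the Gabber–Galil kit (`Literature/Computability/Complexity/ApproximationProofs.lean`):
on the code of a CNF `φ` of width `≤ 3` it outputs the code of
`ggP.dinur φ = (ggP.iterate (⌊log₂ m⌋ + 1) (ofCNF q₀ φ)).toE3CNF` (`GapPV.F_sn_encode`, `strFn_apply`),
elsewhere the code of `noE3` (`GapPV.ggMachine.junk`); `γ := GapPV.ε₁Q ggP`.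

The new content is the OCCURRENCE BOUND, which Dinur's output already satisfies
(`GapE3SATB.countP_mem_dinur_le`, for arbitrary round parameters `P`):

* `GapE3SATB.countP_mem_toE3CNF_le` — occurrence transfer through the E3 rendering `BCSP.toE3CNF` of
  Arora–Barak §11.3.1 (`BCSPToE3CNF.lean`): if the constraints of a `q`-ary instance `φ` reading any
  given variable lie in a finset of size `≤ D₀`, every variable number `v` occurs in at most
  `(D₀ + 2) · 2^q (q + 4)` clauses of `φ.toE3CNF` — the clauses of constraint `s` (`consCNF s`, at most
  `2^q (q + 4)` of them) mention only the variables read by `s` (`BCSP.mem_wideClause`) and the fresh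
  variables `fresh s τ j = nV + (j + q (tcode τ + 2^q s))` with `j < q + 2` (`BCSP.mem_e3Gadget`), and
  a fresh variable number determines `s` up to two candidates, `(v - nV) / (q 2^q) ∈ {s, s + 1}`
  (`GapE3SATB.fresh_sub_div`);
* `GapE3SATB.powAlpha_degree_le` — degree bound of Stage 4 of a round (`LazyCSP.powAlpha`, powering +
  alphabet reduction rendered as `q₀`-ary tester constraints, `Round.lean`/`TesterQueries.lean`): the
  constraint `(s, c)` (walk `s = (v, label)`, coins `c : TCoins k`) reads only the variables
  `inl (wfst s, ·)`, `inl (wsnd s, ·)`, `inr (s, ·)` (`BLR.Table.posVar`/`consVars`), and the walk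
  constraints starting or ending at `u` all start in the ball of radius `2t + 1` around `u`
  (`RotGraph.start_mem_ballList_endpt`, `RotGraph.length_ballList_le`), so a variable is read by at
  most `(ballBound (2dH) (2t+1) · (2dH)^{2t+1} + 1) · tc k` constraints (`GapE3SATB.card_le_of_consVars`);
* the last of the `⌊log₂ m⌋ + 1` rounds of `dinur` is `round` — the identity on an instance without
  constraints (whose E3-CNF is empty), otherwise `powAlpha` of a lazy instance of half-degree `P.dH`.

No definitions, no named facts; everything used is proved in the tree.
-/

set_option linter.dupNamespace false -- `Summit.PneNP.PneNP.…`: summit = sub-problem (D-0017)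

noncomputable section

-- as in `Round.lean`: definitional unfolding may meet `2 ^ q₀`; let `whnf` evaluate it natively
set_option exponentiation.threshold 4096

namespace Summit.PneNP.PneNP.Theorems

namespace GapE3SATB

open Finset
open Literature.Computability.Complexity Literature.Computability.Complexity.Expander
open Literature.Computability.Complexity.Expander.BCSP
open Literature.Computability.Complexity.Expander.RotGraph (ballBound listOfLab length_listOfLab)
open Literature.Computability.Complexity.BLR Literature.Computability.Complexity.BLR.Table

/-! ### Occurrence transfer through `BCSP.toE3CNF` -/

variable {q : ℕ} (φ : BCSP q)

/-- The clauses of one constraint: at most `2^q (q + 4)` (each of the `2^q` blocks is a gadget of at most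
`q + 4` clauses). -/
theorem length_consCNF_le (s : Fin φ.cons.length) : (φ.consCNF s).length ≤ 2 ^ q * (q + 4) := by
  unfold BCSP.consCNF
  rw [List.length_flatMap]
  calc ((allτ q).map fun τ => (φ.block s τ).length).sum ≤ ((allτ q).map fun _ => q + 4).sum := by
        refine List.sum_le_sum fun τ _ => ?_
        unfold BCSP.block
        split_ifs
        · exact (length_e3Gadget_le _ _).trans (Nat.add_le_add_right (φ.length_wideClause_le s τ) _)
        · simp
    _ = 2 ^ q * (q + 4) := by rw [List.map_const', List.sum_replicate, length_allτ, smul_eq_mul]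

/-- `q · 2^q ≥ 2` for `q ≥ 1`. -/
theorem two_le_mul_two_pow (hq : 0 < q) : 2 ≤ q * 2 ^ q :=
  calc 2 = 1 * 2 ^ 1 := by norm_num
    _ ≤ q * 2 ^ q := Nat.mul_le_mul hq (Nat.pow_le_pow_right two_pos hq)

/-- A fresh variable of block `(s, τ)` with slot `j < q + 2` determines `s` up to two candidates:
`(fresh s τ j - nV) / (q 2^q) ∈ {s, s + 1}` (`q ≥ 1`). -/
theorem fresh_sub_div (hq : 0 < q) (s : Fin φ.cons.length) (τ : Fin q → Bool) {j : ℕ} (hj : j < q + 2) :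
    s.val = (φ.fresh s τ j - φ.nV) / (q * 2 ^ q) ∨ s.val + 1 = (φ.fresh s τ j - φ.nV) / (q * 2 ^ q) := by
  have h2 : 2 ≤ q * 2 ^ q := two_le_mul_two_pow hq
  have hM : 0 < q * 2 ^ q := lt_of_lt_of_le two_pos h2
  have hτ : tcode τ < 2 ^ q := (boolVecEquiv q τ).2
  have hr : φ.fresh s τ j - φ.nV = (j + q * tcode τ) + (q * 2 ^ q) * s.val := by
    unfold BCSP.fresh; rw [Nat.add_sub_cancel_left]; ring
  rw [hr, Nat.add_mul_div_left _ _ hM]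
  -- `j + q · tcode τ < 2 · (q 2^q)`
  have h1 : q * tcode τ + q ≤ q * 2 ^ q := by
    have := Nat.mul_le_mul_left q (Nat.succ_le_of_lt hτ); rwa [Nat.mul_succ] at this
  have ha : (j + q * tcode τ) / (q * 2 ^ q) < 2 := by
    rw [Nat.div_lt_iff_lt_mul hM]
    omega
  generalize (j + q * tcode τ) / (q * 2 ^ q) = g at ha ⊢
  omega

/-- **Where a variable can occur.** If `v` is a variable of a clause of the block `(s, τ)` then either
`s` reads `v`, or `s ∈ {c, c - 1}` with `c = (v - nV) / (q 2^q)` (`q ≥ 1`). -/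
theorem mem_block_cases (hq : 0 < q) {s : Fin φ.cons.length} {τ : Fin q → Bool} {d : Clause ℕ}
    (hd : d ∈ φ.block s τ) {v : ℕ} (hv : v ∈ d.map Prod.fst) :
    (∃ i : Fin q, (φ.vars s i : ℕ) = v) ∨
      s.val = (v - φ.nV) / (q * 2 ^ q) ∨ s.val + 1 = (v - φ.nV) / (q * 2 ^ q) := by
  obtain ⟨l, hl, rfl⟩ := List.mem_map.1 hv
  unfold BCSP.block at hd
  split_ifs at hd with h
  · rcases mem_e3Gadget _ _ d hd l hl with hw | ⟨j, hj, hjl⟩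
    · obtain ⟨i, hi⟩ := (φ.mem_wideClause).1 hw
      exact Or.inl ⟨i, by rw [← hi]⟩
    · have hj' : j < q + 2 := lt_of_lt_of_le hj (Nat.add_le_add_right (φ.length_wideClause_le s τ) 2)
      rw [hjl]
      exact Or.inr (fresh_sub_div φ hq s τ hj')
  · simp at hd

/-- **Occurrence transfer through `toE3CNF`.** If, for every variable number `v`, the constraints of `φ`
reading `v` lie in a finset of size at most `D₀`, then every `v` occurs in at most
`(D₀ + 2) · 2^q (q + 4)` clauses of `φ.toE3CNF` (`q ≥ 1`): it can occur only in the `≤ 2^q (q + 4)`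
clauses of a constraint reading it or of one of the two constraints whose fresh variables may hit `v`. -/
theorem countP_mem_toE3CNF_le (hq : 0 < q) {D₀ : ℕ}
    (hD : ∀ v : ℕ, ∃ S : Finset (Fin φ.cons.length), S.card ≤ D₀ ∧
      ∀ s : Fin φ.cons.length, (∃ i : Fin q, (φ.vars s i : ℕ) = v) → s ∈ S)
    (v : ℕ) : (φ.toE3CNF.countP fun cl => v ∈ cl.map Prod.fst) ≤ (D₀ + 2) * (2 ^ q * (q + 4)) := by
  classical
  obtain ⟨S, hS, hmem⟩ := hD v
  set c := (v - φ.nV) / (q * 2 ^ q)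
  set Sv : Finset (Fin φ.cons.length) :=
    S ∪ (univ.filter fun s => s.val = c) ∪ (univ.filter fun s => s.val + 1 = c)
  have hcard : Sv.card ≤ D₀ + 2 := by
    have h1 : (univ.filter fun s : Fin φ.cons.length => s.val = c).card ≤ 1 :=
      Finset.card_le_one.2 fun a ha b hb => Fin.ext (by rw [(mem_filter.1 ha).2, (mem_filter.1 hb).2])
    have h2 : (univ.filter fun s : Fin φ.cons.length => s.val + 1 = c).card ≤ 1 :=
      Finset.card_le_one.2 fun a ha b hb =>
        Fin.ext (by have := (mem_filter.1 ha).2; have := (mem_filter.1 hb).2; omega)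
    have h3 := card_union_le (S ∪ (univ.filter fun s : Fin φ.cons.length => s.val = c))
      (univ.filter fun s : Fin φ.cons.length => s.val + 1 = c)
    have h4 := card_union_le S (univ.filter fun s : Fin φ.cons.length => s.val = c)
    simp only [Sv]
    omega
  set g : Fin φ.cons.length → ℕ := fun s => (φ.consCNF s).countP fun cl => v ∈ cl.map Prod.fst
  have hzero : ∀ s, s ∉ Sv → g s = 0 := by
    intro s hs
    simp only [g]
    rw [List.countP_eq_zero]
    intro d hd hvd
    simp only [decide_eq_true_eq] at hvd
    simp only [BCSP.consCNF, List.mem_flatMap] at hd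
    obtain ⟨τ, -, hd⟩ := hd
    apply hs
    rcases mem_block_cases φ hq hd hvd with h | h | h
    · exact mem_union_left _ (mem_union_left _ (hmem s h))
    · exact mem_union_left _ (mem_union_right _ (mem_filter.2 ⟨mem_univ _, h⟩))
    · exact mem_union_right _ (mem_filter.2 ⟨mem_univ _, h⟩)
  have hle : ∀ s, g s ≤ 2 ^ q * (q + 4) := fun s => List.countP_le_length.trans (length_consCNF_le φ s)
  unfold BCSP.toE3CNF
  rw [List.countP_flatMap, ← Fin.sum_univ_def]
  change ∑ s, g s ≤ _
  calc ∑ s, g s = ∑ s ∈ Sv, g s := (Finset.sum_subset (subset_univ Sv) fun s _ hs => hzero s hs).symm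
    _ ≤ ∑ _s ∈ Sv, 2 ^ q * (q + 4) := sum_le_sum fun s _ => hle s
    _ = Sv.card * (2 ^ q * (q + 4)) := by rw [sum_const, smul_eq_mul]
    _ ≤ (D₀ + 2) * (2 ^ q * (q + 4)) := Nat.mul_le_mul_right _ hcard


/-! ### Degree bound of the last Dinur round -/

/-- `posVar s p = inl (u, x)` forces `u ∈ {fst s, snd s}`. -/
theorem posVar_eq_inl {V S : Type} {k : ℕ} (fst snd : S → V) (s : S) (p : Pos k) {u : V} {x : Fin k → Bool}
    (h : posVar fst snd s p = Sum.inl (u, x)) : fst s = u ∨ snd s = u := by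
  rcases p with x' | y | z | z
  · simp only [posVar, Sum.inl.injEq, Prod.mk.injEq] at h; exact Or.inl h.1
  · simp only [posVar, Sum.inl.injEq, Prod.mk.injEq] at h; exact Or.inr h.1
  · simp [posVar] at h
  · simp [posVar] at h

/-- `posVar s p = inr (s₀, z)` forces `s = s₀`. -/
theorem posVar_eq_inr {V S : Type} {k : ℕ} (fst snd : S → V) (s : S) (p : Pos k) {s₀ : S}
    {z : (Fin (nv k) → Bool) ⊕ (Fin (nv k * nv k) → Bool)}
    (h : posVar fst snd s p = Sum.inr (s₀, z)) : s = s₀ := by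
  rcases p with x' | y | z' | z'
  · simp [posVar] at h
  · simp [posVar] at h
  · simp only [posVar, Sum.inr.injEq, Prod.mk.injEq] at h; exact h.1
  · simp only [posVar, Sum.inr.injEq, Prod.mk.injEq] at h; exact h.1

/-- `|TCoins k| = tc k`. -/
theorem card_TCoins (k : ℕ) : Fintype.card (TCoins k) = Enc.tc k := by
  rw [← Fintype.card_fin (Enc.tc k)]; exact Fintype.card_congr (Enc.tcoinsFin k)

variable (P : RoundParams) (ψ : LazyCSP) (k : ℕ)

/-- **The pairs (walk constraint, coins) whose tester constraint reads a given variable `w` are few**: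
at most `(ballBound (2dH) (2t+1) · (2dH)^{2t+1} + 1) · tc k`.  A table bit `U_u(x)` is read only by
walk constraints starting or ending at `u`, and both kinds start in the ball of radius `2t+1` around
`u` (`start_mem_ballList_endpt`); a proof bit of `Π_{s₀}` is read only by the constraints of `s₀`. -/
theorem card_le_of_consVars (w : AlphabetReduction.NewVar (Fin ψ.n) (ψ.S₄ P) k) (T : Finset (ψ.S₄ P × TCoins k))
    (hT : ∀ p ∈ T, ∃ i, consVars (ψ.wfst P) (ψ.wsnd P) (ψ.wrel P k) p.1 p.2 i = w) :
    T.card ≤ (ballBound (ψ.dH + ψ.dH) (2 * P.t + 1) * (ψ.dH + ψ.dH) ^ (2 * P.t + 1) + 1) * Enc.tc k := by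
  classical
  have htc : (univ : Finset (TCoins k)).card = Enc.tc k := by rw [card_univ, card_TCoins]
  rcases w with ⟨u, x⟩ | ⟨s₀, z⟩
  · -- every such pair starts in the ball around `u`
    have hsub : T ⊆ ((ψ.G.lazy.ballList (2 * P.t + 1) u).toFinset ×ˢ
        (univ : Finset (Fin ((ψ.dH + ψ.dH) ^ (2 * P.t + 1))))) ×ˢ (univ : Finset (TCoins k)) := by
      intro p hp
      obtain ⟨i, hi⟩ := hT p hp
      simp only [mem_product, List.mem_toFinset, mem_univ, and_true]
      rcases posVar_eq_inl _ _ _ _ hi with h | h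
      · rw [← h]; exact RotGraph.self_mem_ballList _ _ _
      · rw [← h]; exact RotGraph.start_mem_ballList_endpt _ _ (by rw [length_listOfLab])
    refine (card_le_card hsub).trans ?_
    rw [card_product, card_product, card_univ, Fintype.card_fin, htc]
    have hb := (List.toFinset_card_le _).trans (ψ.G.lazy.length_ballList_le (2 * P.t + 1) u)
    have := Nat.mul_le_mul_right ((ψ.dH + ψ.dH) ^ (2 * P.t + 1)) hb
    nlinarith [this]
  · have hsub : T ⊆ ({s₀} : Finset (ψ.S₄ P)) ×ˢ (univ : Finset (TCoins k)) := by
      intro p hp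
      obtain ⟨i, hi⟩ := hT p hp
      rw [mem_product, mem_singleton]
      exact ⟨posVar_eq_inr _ _ _ _ hi, mem_univ _⟩
    refine (card_le_card hsub).trans ?_
    rw [card_product, card_singleton, htc]
    exact Nat.mul_le_mul_right _ (Nat.le_add_left 1 _)

/-- The positions read by constraint `s` of Stage 4: `newVarFin ∘ consVars … (scOf s)`. -/
theorem powAlpha_vars (s : Fin (ψ.powAlpha P k).cons.length) :
    (ψ.powAlpha P k).vars s = Enc.newVarFin _ _ k ∘
      consVars (ψ.wfst P) (ψ.wsnd P) (ψ.wrel P k) (ψ.scOf P k s).1 (ψ.scOf P k s).2 := by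
  have hget : (ψ.powAlpha P k).cons[s] = ψ.consOf P k ⟨s.val, lt_of_lt_of_eq s.2 (ψ.powAlpha_length P k)⟩ := by
    show (List.ofFn (ψ.consOf P k))[s.val] = _
    rw [List.getElem_ofFn]
  unfold BCSP.vars
  rw [hget]
  rfl

/-- **Degree bound of Stage 4.** For every variable number `v`, the constraints of `ψ.powAlpha P k`
reading `v` lie in a finset of size at most `(ballBound (2dH) (2t+1) · (2dH)^{2t+1} + 1) · tc k`. -/
theorem powAlpha_degree_le (v : ℕ) : ∃ S : Finset (Fin (ψ.powAlpha P k).cons.length),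
    S.card ≤ (ballBound (ψ.dH + ψ.dH) (2 * P.t + 1) * (ψ.dH + ψ.dH) ^ (2 * P.t + 1) + 1) * Enc.tc k ∧
    ∀ s : Fin (ψ.powAlpha P k).cons.length, (∃ i : Fin q₀, ((ψ.powAlpha P k).vars s i : ℕ) = v) → s ∈ S := by
  classical
  by_cases h : ∃ s : Fin (ψ.powAlpha P k).cons.length, ∃ i : Fin q₀, ((ψ.powAlpha P k).vars s i : ℕ) = v
  · obtain ⟨s₀, i₀, h₀⟩ := h
    set cv : ψ.S₄ P × TCoins k → Fin q₀ → AlphabetReduction.NewVar (Fin ψ.n) (ψ.S₄ P) k :=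
      fun p i => consVars (ψ.wfst P) (ψ.wsnd P) (ψ.wrel P k) p.1 p.2 i with hcv
    set w := cv (ψ.scOf P k s₀) i₀ with hw
    refine ⟨univ.filter fun s => ∃ i, cv (ψ.scOf P k s) i = w, ?_, ?_⟩
    · have hinj : Set.InjOn (ψ.scOf P k) ↑(univ.filter fun s => ∃ i, cv (ψ.scOf P k s) i = w) :=
        fun a _ b _ hab => (ψ.scOf_bijective P k).1 hab
      refine (card_le_card_of_injOn (ψ.scOf P k) (fun s hs => ?_) hinj).trans
        (card_le_of_consVars P ψ k w (univ.filter fun p => ∃ i, cv p i = w) fun p hp => (mem_filter.1 hp).2)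
      exact mem_filter.2 ⟨mem_univ _, (mem_filter.1 hs).2⟩
    · rintro s ⟨i, hi⟩
      refine mem_filter.2 ⟨mem_univ _, i, ?_⟩
      have h1 : (ψ.powAlpha P k).vars s i = (ψ.powAlpha P k).vars s₀ i₀ := Fin.ext (by rw [hi, h₀])
      rw [powAlpha_vars, powAlpha_vars] at h1
      exact (Enc.newVarFin _ _ k).injective h1
  · exact ⟨∅, Nat.zero_le _, fun s hs => (h ⟨s, hs⟩).elim⟩

/-- **Occurrence bound of Dinur's map.** For every choice of round parameters `P` there is `B₀` such that
every variable occurs in at most `B₀` clauses of `P.dinur φ`, for every CNF `φ`: the last of the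
`⌊log₂ m⌋ + 1` rounds is `round`, the identity on an instance without constraints (whose E3-CNF is empty)
and otherwise Stage 4 `powAlpha` of a lazy instance of degree `dH = P.dH`, so `powAlpha_degree_le` and the
occurrence transfer `countP_mem_toE3CNF_le` apply with constants depending on `P` only. -/
theorem countP_mem_dinur_le : ∃ B₀ : ℕ, ∀ (φ : CNF ℕ) (v : ℕ),
    ((P.dinur φ).countP fun cl => v ∈ cl.map Prod.fst) ≤ B₀ := by
  refine ⟨((ballBound P.D (2 * P.t + 1) * P.D ^ (2 * P.t + 1) + 1) * Enc.tc P.k₄ + 2) * (2 ^ q₀ * (q₀ + 4)),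
    fun φ v => ?_⟩
  unfold RoundParams.dinur
  rw [RoundParams.iterate]
  set χ := P.iterate (Nat.log 2 φ.length) (BCSP.ofCNF q₀ φ)
  by_cases h0 : χ.cons.length = 0
  · rw [P.round_of_eq_zero χ h0]
    refine List.countP_le_length.trans ((BCSP.length_toE3CNF_le χ).trans ?_)
    rw [h0, zero_mul]
    exact Nat.zero_le _
  · rw [RoundParams.round, if_neg h0]
    exact countP_mem_toE3CNF_le _ RoundParams.q₀_pos (powAlpha_degree_le P _ P.k₄) v

end GapE3SATB

/-! ### The stub -/

open Filter
open Literature.Computability.Complexity Literature.Computability.MetaComplexity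
open _root_.Computability
open Literature.Computability.Complexity.GabberGalil (ggP gg_dinur_isExactWidth gg_dinur_satisfiable
  gg_dinur_maxSatFraction_le)

/-- **S2a — bounded-occurrence gap-E3SAT is NP-hard, from the tree's own PCP machine.** For every `NP`
language `L` there are `g ∈ FP`, a gap `γ > 0` and an occurrence bound `B` such that `g` maps EVERY
string `y` to the code of an E3-CNF in which every variable occurs in at most `B` clauses, satisfiable
if `y ∈ L` and of value `≤ 1 - γ` if `y ∉ L`: `g := GapPV.ggMachine.g ∘ r = strFn GapPV.pv_F ∘ r` with
`r` the Cook–Levin reduction to `kSAT 3`, `γ := GapPV.ε₁Q ggP`, and `B := B₀ + 8` with `B₀` the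
occurrence bound of `ggP.dinur` (`GapE3SATB.countP_mem_dinur_le`) and `8 = |noE3|` (the junk output). -/
theorem stub_gapE3SATB : ∀ L : Language Bool, L ∈ Nondeterministic.NP →
    ∃ (g : List Bool → List Bool) (γ : ℚ) (B : ℕ), g ∈ FP ∧ 0 < γ ∧
      ∀ y : List Bool, ∃ φ : CNF ℕ, g y = encodingCNF.encode φ ∧ φ.IsExactWidth 3 ∧
        (∀ v : ℕ, (φ.countP fun cl => v ∈ cl.map Prod.fst) ≤ B) ∧
        (y ∈ L → φ.Satisfiable) ∧ (y ∉ L → φ.maxSatFraction ≤ 1 - γ) := by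
  intro L hL
  obtain ⟨r, hr, hspec⟩ := (isNPComplete_kSAT_three_holds).2 L hL
  obtain ⟨B₀, hB₀⟩ := GapE3SATB.countP_mem_dinur_le ggP
  -- `g := GapPV.ggMachine.g ∘ r`, with `GapPV.ggMachine.g = strFn GapPV.pv_F` written out
  refine ⟨strFn GapPV.pv_F ∘ r, GapPV.ε₁Q ggP, B₀ + 8, comp_mem_FP (strFn_mem_FP GapPV.pv_F) hr,
    GapPV.ε₁Q_pos _, fun y => ?_⟩
  by_cases hcode : ∃ φ : CNF ℕ, φ.IsWidthLE 3 ∧ encodingCNF.encode φ = r y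
  · -- `r y` codes a 3CNF `φ`: the output is the code of `ggP.dinur φ`
    obtain ⟨φ, hw, hφ⟩ := hcode
    have hg : (strFn GapPV.pv_F ∘ r) y = encodingCNF.encode (ggP.dinur φ) := by
      show strFn GapPV.pv_F (r y) = _
      rw [← hφ]
      exact strFn_apply GapPV.pv_F (GapPV.F_sn_encode hw)
    refine ⟨ggP.dinur φ, hg, gg_dinur_isExactWidth φ, fun v => (hB₀ φ v).trans (Nat.le_add_right _ _),
      fun hy => ?_, fun hy => ?_⟩
    · obtain ⟨φ', ⟨-, hsat'⟩, hφ'⟩ := (hspec y).1 hy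
      have hφφ : φ' = φ := encodingCNF.encode_injective (hφ'.trans hφ.symm)
      subst hφφ
      exact gg_dinur_satisfiable hw hsat'
    · have hunsat : ¬ φ.Satisfiable := fun hs => hy ((hspec y).2 (hφ ▸ ⟨φ, ⟨hw, hs⟩, rfl⟩))
      have h1 := gg_dinur_maxSatFraction_le hw hunsat
      rw [← GapPV.ε₁Q_cast] at h1
      exact_mod_cast h1
  · -- junk input: the output is the code of `noE3`, and `y ∉ L`
    push Not at hcode
    have hg : (strFn GapPV.pv_F ∘ r) y = encodingCNF.encode noE3 :=
      strFn_apply GapPV.pv_F (GapPV.F_junk fun φ hw => hcode φ hw)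
    have hlen : noE3.length = 8 := rfl
    refine ⟨noE3, hg, isExactWidth_noE3, fun v => List.countP_le_length.trans (by rw [hlen]; omega),
      fun hy => ?_, fun _ => ?_⟩
    · obtain ⟨φ', ⟨hw', -⟩, hφ'⟩ := (hspec y).1 hy
      exact absurd hφ' (hcode φ' hw')
    · have hε := GapPV.ε₁Q_le ggP
      linarith [maxSatFraction_noE3_le]

end Summit.PneNP.PneNP.Theorems

end
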